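import Summits.QuantumFields.YangMills.Theorems.UnitScaleTiltProp7OneFormKatoBootstrap
import Summits.QuantumFields.YangMills.Theorems.UnitScaleTiltProp7BlockDistanceWeights
import Literature.MathematicalPhysics.QuantumFieldTheory.Balaban1983to89.B9Eq369Small
import HarnessLib

/-!
# Route `UnitScaleTilt`, crux K1 «MinimiserStabilityRegPr» (stmt-QuantumFields-19200), EX face S45 — (L3′b)-VALUE, ONE-FORM STOREY, FILE (O4-loc):
# **THE DECAYED LOCAL-STENCIL LETTER OF O4's `hqdom`** — O1's `p_∞` letter ✓`Prop7OneFormKatoForm.norm_local_remainder_le_of_regPr` LOCALISED to the radius-2 ball of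
# the evaluation bond, then read against a decaying envelope `S·e^{−κ·d}`; the block-distance Lipschitz letter discharged; the four-term `hqdom` assembled from letters

Cell `ym3-torus` (HUMAN RULING D-0037; rung R3 = SU(2) YM₃ on T³ — NOT d = 4, NOT infinite volume, NOT a mass gap, NOT Clay).  Chair ★`ym-ust-19200-p1` g26, 07:33:42Z ∕ CHAIR WORD
№9 (v): «`hqdom` … local stencil `θ = 32√2ε₀e^{κ}` — suppliers welcome»; typed by width seat `ym3-torus-px16` g13 (`--supports stmt-QuantumFields-19200 --as helper`).  THEOREMS ONLY
(0 `def`, 0 `sorry`, default heartbeats); count-neutral.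

WHY.  O4 ✓`Prop7OneFormPointwiseDecay.pointwiseDecay_oneForm_of_letters` displays the remainder letter
`hqdom : ∀ p, ‖q p‖ ≤ (s_D + θ·⨆_{p′} ‖u(p′)‖e^{κ·d p′})·e^{−κ·d p}` for (O3d)'s four-term remainder
`q = aQ_k†Q_k u − D(1−R_S)D*u + (Δx − Δ^η)u + η⁻²(Δ′₁ − 𝒦)(toL2⁻¹u)`.  The fourth (LOCAL-STENCIL) term is `O(ε₀)·sup‖u‖` by O1's ✓`norm_local_remainder_le_of_regPr` — but that
letter takes a GLOBAL sup `∀ b, ‖X b‖ ≤ s`, useless against a decaying envelope.  THIS FILE localises it by TRUNCATION: `Δ′₁` reads the one-form only on the boundary bonds of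
the plaquettes through `b` (lit ✓`B9Eq369Small.deltaPrimeOp_congr_local`, print's `st(b)`) and `𝒦` only on the bonds `(ν, x + e_μ − e_ν)` (its definition, lit `B11Eq135Weitzenbock.curvOp`);
all of them have source within `ℓ¹`-distance `2` of `b.src`, so the global letter applied to the field truncated to that ball gives the local letter with the SAME constant `32ε₀`.
WHAT IS PROVED (ns `Summit.QuantumFields.YangMills.Theorems.Prop7OneFormLocalRemainderDecay`; member `F`, `n K`, `ℓ = L^{K−n} = η⁻¹`).
* §1 ★ `norm_local_remainder_le_of_regPr_local` — on `RegPr F n K ε₀ U₀`: `‖η⁻¹•η⁻¹•((Δ′₁X)(b) − (𝒦X)(b))‖ ≤ 32·ε₀·s` whenever `‖X b′‖ ≤ s` for the bonds `b′` with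
  `tdist b.src b′.src ≤ 2` ONLY (`0 ≤ s`).
* §2 ★★ `norm_local_remainder_le_decay` — the DECAYED edition on the lit bond carrier (the fourth summand of O4's `hq` VERBATIM, `X = toL2⁻¹u`): for ANY `d : Bond → ℝ`, `κ ≥ 0`
  and a displayed stencil-Lipschitz letter `hd : tdist (p)₋ (p′)₋ ≤ 2 → d p ≤ d p′ + r`:
  `‖frobEquiv⁻¹(η⁻¹•η⁻¹•((Δ′₁X)(p) − (𝒦X)(p)))‖ ≤ 32√2·ε₀·e^{κr}·(⨆_{p′} ‖u(p′)‖e^{κ·d p′})·e^{−κ·d p}` — the `θ·S` half of `hqdom` with `θ := 32√2ε₀e^{κr}`.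
* §3 ★ `blockDist_le_blockDist_add_five` — the Lipschitz letter DISCHARGED for O4b's block distance `d p := tdist(B((bondEquiv)⁻¹p)₋, v)` with `r := 5`
  (✓`Prop7BlockDistanceWeights.tdist_iterBlockOf_le`: `tdist(Bx, Bx′) ≤ tdist(x,x′)∕ℓ + 3 ≤ 5`, then the coarse triangle inequality); `norm_local_remainder_le_blockDecay` = §2 at this `d`.
* §4 ★★ `hqdom_of_letters` — O4's `hqdom` ASSEMBLED: decayed letters `‖tᵢ(p)‖ ≤ (sᵢ + θᵢ·S)·e^{−κ·d p}` for the (Q), (D), (X) summands (ANY functions `t₁ t₂ t₃`, so the (P-Q†)∕(COL),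
  h349-class and slot suppliers dock by name) + §2 ⟹ `‖q p‖ ≤ ((s₁+s₂+s₃) + (θ₁+θ₂+θ₃+32√2ε₀e^{κr})·S)·e^{−κ·d p}` — O4's binder text with `sD := s₁+s₂+s₃`, `θ := θ₁+θ₂+θ₃+32√2ε₀e^{κr}`.
HONEST SCOPE.  Bookkeeping over O1's landed letter and two lit locality rows; the (Q)∕(D)∕(X) decayed letters stay DISPLAYED ((Q) rests on (P-Q†)∕(COL)); nothing of the ten EX rows,
`hT`, (3.42) for print's `G`∕`H`, EX or the crux is proved here; no summit is proved by a helper.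

References: T. Bałaban, CMP **99** (1985) 389–434 [Balaban1985BackgroundPropagators] ((3.10) p.392, (3.69) p.404 «the supremum … is taken over bonds belonging to one of the
plaquettes containing the bond b», (3.42) p.397); CMP **102** (1985) 277–309 [Balaban1985Variational] ((14) p.280, (135)–(136) p.298, p.299).
-/

set_option autoImplicit false

noncomputable section

open scoped Matrix.Norms.L2Operator BigOperators

namespace Summit.QuantumFields.YangMills.Theorems.Prop7OneFormLocalRemainderDecay

open Literature.MathematicalPhysics.QuantumFieldTheory.Balaban1983to89
open Literature.MathematicalPhysics.QuantumFieldTheory.Balaban1983to89.T3ContinuumYM3Torus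
open Literature.MathematicalPhysics.QuantumFieldTheory.Balaban1983to89.T3PrintedRegularMinimiser (RegPr)
open T3SectALandauChart (formComp bgUnits eta eta_pos)
open B4Sect5Torus (TSite)
open B9SectCLatticeCarrier (Bond)
open B9Eq311L2Pairing (WL2)
open B9TorusCalculus (torusT torusT_apply torusT_symm_apply)
open B9Eq310Hermitian (deltaPrimeOp)
open B9Eq369Small (Through deltaPrimeOp_congr_local)
open B11Eq135Weitzenbock (curvOp)
open B11Eq103H1Complex (BondL2K)
open B5Eq118OneStroke (iterBlockOf)
open B3Taylor310LocalRemainder (tdist_comm tdist_triangle tdist_self)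
open Summit.QuantumFields.Balaban3D.Proofs.Run3Collar (tdist_shift_le)
open Summit.QuantumFields.YangMills.Theorems.Prop7SectET3Transport (periodsT3 siteEquiv bondEquiv bondEquiv_symm_apply)
open Summit.QuantumFields.YangMills.Theorems.Prop7SectET3HilbertLetters (W₂ frobEquiv toL2 toL2_symm_apply)
open Summit.QuantumFields.YangMills.Theorems.Prop7RieszTauFrobNorm (norm_frobEquiv_le norm_frobEquiv_symm_le)
open Summit.QuantumFields.YangMills.Theorems.Prop7OneFormKatoForm (norm_local_remainder_le_of_regPr)
open Summit.QuantumFields.YangMills.Theorems.Prop7BlockDistanceWeights (tdist_iterBlockOf_le)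

variable {F : T3Family} {n K : ℕ} {c₀ : ℝ}

/-! ## §1 The `p_∞` letter, LOCALISED to the radius-2 ball of the evaluation bond -/

/-- ★ **THE LOCAL `p_∞` LETTER**: on `RegPr F n K ε₀ U₀`, if `‖X(b′)‖ ≤ s` (`0 ≤ s`) for the bonds `b′` whose source is within `ℓ¹`-distance `2` of `b.src` ONLY, then
`‖η⁻¹•η⁻¹•((Δ′₁X)(b) − (𝒦X)(b))‖ ≤ 32·ε₀·s` — O1's ✓`norm_local_remainder_le_of_regPr` applied to the field TRUNCATED to that ball, which `Δ′₁` (lit ✓`deltaPrimeOp_congr_local`: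
the boundary bonds of the plaquettes through `b`) and `𝒦` (its defining sum over the bonds `(ν, x + e_μ − e_ν)`) cannot distinguish from `X` at `b`.
[cite: Balaban1985BackgroundPropagators, (3.69) p.404, (3.10) p.392; Balaban1985Variational, (14) p.280, (135)–(136) p.298] -/
theorem norm_local_remainder_le_of_regPr_local {ε₀ : ℝ} (U₀ : GaugeField (F.P K) 0 (Matrix.specialUnitaryGroup (Fin 2) ℂ)) (hreg : RegPr F n K ε₀ U₀)
    {X : PBond (F.P K) 0 → Matrix (Fin 2) (Fin 2) ℂ} (b : PBond (F.P K) 0) {s : ℝ} (hs : 0 ≤ s)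
    (hX : ∀ b' : PBond (F.P K) 0, Site.tdist b.src b'.src ≤ 2 → ‖X b'‖ ≤ s) :
    ‖(eta F n K)⁻¹ • (eta F n K)⁻¹ •
        (deltaPrimeOp (torusT (F.P K) 0) (fun μ x => bgUnits F K U₀ ⟨x, μ⟩) 1 (formComp X) b.dir b.src
          - curvOp (torusT (F.P K) 0) (fun μ x => bgUnits F K U₀ ⟨x, μ⟩) (formComp X) b.dir b.src)‖ ≤ 32 * ε₀ * s := by
  classical
  -- the truncated field and its global sup
  set X' : PBond (F.P K) 0 → Matrix (Fin 2) (Fin 2) ℂ := fun b' => if Site.tdist b.src b'.src ≤ 2 then X b' else 0 with hX'def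
  have hX' : ∀ b', ‖X' b'‖ ≤ s := fun b' => by
    rw [hX'def]; dsimp only
    split_ifs with hb'
    · exact hX b' hb'
    · rw [norm_zero]; exact hs
  have heq : ∀ (κ : Fin (F.P K).d) (z : Site (F.P K) 0), Site.tdist b.src z ≤ 2 → formComp X κ z = formComp X' κ z := fun κ z hz => by
    show X ⟨z, κ⟩ = X' ⟨z, κ⟩
    rw [hX'def]; dsimp only
    rw [if_pos hz]
  -- elementary distances on the fine torus
  have hun : ∀ (x : Site (F.P K) 0) (μ : Fin (F.P K).d), Site.tdist x (x.unshift μ) ≤ 1 := fun x μ => by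
    have e : (x.unshift μ).shift μ = x := by
      have h := (torusT (F.P K) 0 μ).apply_symm_apply x
      rwa [torusT_symm_apply, torusT_apply] at h
    calc Site.tdist x (x.unshift μ) = Site.tdist (x.unshift μ) x := tdist_comm _ _
      _ = Site.tdist (x.unshift μ) ((x.unshift μ).shift μ) := by rw [e]
      _ ≤ 1 := tdist_shift_le _ _
  have hsh : ∀ (x y : Site (F.P K) 0) (μ : Fin (F.P K).d), Site.tdist x (y.shift μ) ≤ Site.tdist x y + 1 := fun x y μ =>
    (tdist_triangle x y (y.shift μ)).trans (Nat.add_le_add_left (tdist_shift_le y μ) _)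
  -- `Δ′₁` reads `X` only on `st(b)`
  have hΔ : deltaPrimeOp (torusT (F.P K) 0) (fun μ x => bgUnits F K U₀ ⟨x, μ⟩) 1 (formComp X) b.dir b.src
      = deltaPrimeOp (torusT (F.P K) 0) (fun μ x => bgUnits F K U₀ ⟨x, μ⟩) 1 (formComp X') b.dir b.src := by
    refine deltaPrimeOp_congr_local (torusT (F.P K) 0) (fun μ x => bgUnits F K U₀ ⟨x, μ⟩) 1 b.dir b.src fun κ ν y hthr => ?_
    have hy : Site.tdist b.src y ≤ 1 := by
      rcases hthr with ⟨-, ⟨-, rfl | rfl⟩ | ⟨-, rfl | rfl⟩⟩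
      · rw [tdist_self]; exact zero_le_one
      · rw [torusT_symm_apply]; exact hun _ _
      · rw [tdist_self]; exact zero_le_one
      · rw [torusT_symm_apply]; exact hun _ _
    have h1 : Site.tdist b.src y ≤ 2 := hy.trans one_le_two
    have h2 : Site.tdist b.src (torusT (F.P K) 0 κ y) ≤ 2 := by rw [torusT_apply]; exact (hsh _ _ _).trans (by omega)
    have h3 : Site.tdist b.src (torusT (F.P K) 0 ν y) ≤ 2 := by rw [torusT_apply]; exact (hsh _ _ _).trans (by omega)
    exact ⟨heq _ _ h1, heq _ _ h2, heq _ _ h3, heq _ _ h1⟩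
  -- `𝒦` reads `X` only on the bonds `(ν, x + e_μ − e_ν)`
  have hK : curvOp (torusT (F.P K) 0) (fun μ x => bgUnits F K U₀ ⟨x, μ⟩) (formComp X) b.dir b.src
      = curvOp (torusT (F.P K) 0) (fun μ x => bgUnits F K U₀ ⟨x, μ⟩) (formComp X') b.dir b.src := by
    unfold curvOp
    refine Finset.sum_congr rfl fun ν _ => ?_
    have hz : Site.tdist b.src ((torusT (F.P K) 0 ν).symm (torusT (F.P K) 0 b.dir b.src)) ≤ 2 := by
      rw [torusT_apply, torusT_symm_apply]
      calc Site.tdist b.src ((b.src.shift b.dir).unshift ν)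
          ≤ Site.tdist b.src (b.src.shift b.dir) + Site.tdist (b.src.shift b.dir) ((b.src.shift b.dir).unshift ν) := tdist_triangle _ _ _
        _ ≤ 1 + 1 := add_le_add (tdist_shift_le _ _) (hun _ _)
    rw [heq ν _ hz]
  rw [hΔ, hK]
  exact norm_local_remainder_le_of_regPr F U₀ hreg hX' b

/-! ## §2 The decayed edition on the lit bond carrier (the fourth summand of O4's `hq`, verbatim) -/

/-- ★★ **THE DECAYED LOCAL-STENCIL LETTER.**  On `RegPr F n K ε₀ U₀`, for `u ∈ L²` (vector fields on the lit bond carrier), ANY `d : Bond → ℝ`, `κ ≥ 0` and a stencil-Lipschitz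
letter `d p ≤ d p′ + r` whenever the sources of `p`, `p′` are within `ℓ¹`-distance `2`: the local-stencil summand of (O3d)'s remainder at `p` is dominated by the decaying envelope,
`‖frobEquiv⁻¹(η⁻¹•η⁻¹•((Δ′₁X)(p) − (𝒦X)(p)))‖ ≤ 32√2·ε₀·e^{κr}·(⨆_{p′} ‖u(p′)‖e^{κ·d p′})·e^{−κ·d p}` (`X = toL2⁻¹u`; `√2` = ✓`norm_frobEquiv_symm_le`) — the `θ·S` half of O4's
`hqdom` with `θ := 32√2·ε₀·e^{κr}`. [cite: Balaban1985BackgroundPropagators, (3.69) p.404, (3.42) p.397; Balaban1985Variational, (14) p.280, p.299] -/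
theorem norm_local_remainder_le_decay {ε₀ : ℝ} (U₀ : GaugeField (F.P K) 0 (Matrix.specialUnitaryGroup (Fin 2) ℂ)) (hreg : RegPr F n K ε₀ U₀)
    (u : BondL2K ℂ 3 (periodsT3 F K) c₀ W₂) (d : Bond 3 (periodsT3 F K) → ℝ) {κ r : ℝ} (hκ : 0 ≤ κ)
    (hd : ∀ p p' : Bond 3 (periodsT3 F K), Site.tdist ((bondEquiv F K).symm p).src ((bondEquiv F K).symm p').src ≤ 2 → d p ≤ d p' + r)
    (p : Bond 3 (periodsT3 F K)) :
    ‖(frobEquiv.symm ((eta F n K)⁻¹ • (eta F n K)⁻¹ •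
        (deltaPrimeOp (torusT (F.P K) 0) (fun ν x => bgUnits F K U₀ ⟨x, ν⟩) 1 (formComp ((toL2 F K c₀).symm u)) p.2 ((siteEquiv F K).symm p.1)
          - curvOp (torusT (F.P K) 0) (fun ν x => bgUnits F K U₀ ⟨x, ν⟩) (formComp ((toL2 F K c₀).symm u)) p.2 ((siteEquiv F K).symm p.1))) : W₂)‖
      ≤ 32 * Real.sqrt 2 * ε₀ * Real.exp (κ * r) * (⨆ p', ‖WL2.equiv ℂ _ W₂ u p'‖ * Real.exp (κ * d p')) * Real.exp (-(κ * d p)) := by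
  haveI : Nonempty (Bond 3 (periodsT3 F K)) := ⟨p⟩
  set g : Bond 3 (periodsT3 F K) → ℝ := fun p' => ‖WL2.equiv ℂ _ W₂ u p'‖ * Real.exp (κ * d p') with hg
  set S : ℝ := ⨆ p', g p' with hS
  have hbdd : BddAbove (Set.range g) := (Set.finite_range _).bddAbove
  have hgS : ∀ p', g p' ≤ S := fun p' => le_ciSup hbdd p'
  have hS0 : 0 ≤ S := le_trans (by positivity : (0 : ℝ) ≤ g p) (hgS p)
  -- the envelope: `‖u(p′)‖ ≤ S·e^{−κ·d p′}`
  have henv : ∀ p', ‖WL2.equiv ℂ _ W₂ u p'‖ ≤ S * Real.exp (-(κ * d p')) := fun p' => by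
    have h1 := mul_le_mul_of_nonneg_right (hgS p') (Real.exp_pos (-(κ * d p'))).le
    have e : g p' * Real.exp (-(κ * d p')) = ‖WL2.equiv ℂ _ W₂ u p'‖ := by
      rw [hg]; dsimp only; rw [mul_assoc, ← Real.exp_add, add_neg_cancel, Real.exp_zero, mul_one]
    rwa [e] at h1
  -- the local sup on the radius-2 ball around `p`'s source, read on the route carrier
  set b : PBond (F.P K) 0 := (bondEquiv F K).symm p with hb
  have hs : 0 ≤ S * Real.exp (κ * r) * Real.exp (-(κ * d p)) := by positivity
  have hX : ∀ b' : PBond (F.P K) 0, Site.tdist b.src b'.src ≤ 2 → ‖(toL2 F K c₀).symm u b'‖ ≤ S * Real.exp (κ * r) * Real.exp (-(κ * d p)) := by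
    intro b' hb'
    have hdp : d p ≤ d (bondEquiv F K b') + r := hd p (bondEquiv F K b') (by rwa [Equiv.symm_apply_apply])
    have hexp : Real.exp (-(κ * d (bondEquiv F K b'))) ≤ Real.exp (κ * r) * Real.exp (-(κ * d p)) := by
      rw [← Real.exp_add]
      exact Real.exp_le_exp.mpr (by nlinarith)
    rw [toL2_symm_apply]
    calc ‖frobEquiv (WL2.equiv ℂ _ W₂ u (bondEquiv F K b'))‖ ≤ ‖WL2.equiv ℂ _ W₂ u (bondEquiv F K b')‖ := norm_frobEquiv_le _
      _ ≤ S * Real.exp (-(κ * d (bondEquiv F K b'))) := henv _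
      _ ≤ S * (Real.exp (κ * r) * Real.exp (-(κ * d p))) := mul_le_mul_of_nonneg_left hexp hS0
      _ = S * Real.exp (κ * r) * Real.exp (-(κ * d p)) := by ring
  -- §1 at `b = (bondEquiv)⁻¹ p`, then `‖frobEquiv⁻¹ w‖ ≤ √2‖w‖`
  have h1 := norm_local_remainder_le_of_regPr_local U₀ hreg b hs hX
  rw [hb, bondEquiv_symm_apply] at h1
  refine (norm_frobEquiv_symm_le _).trans ?_
  have h2 : 0 ≤ Real.sqrt 2 := Real.sqrt_nonneg _
  calc Real.sqrt 2 * ‖(eta F n K)⁻¹ • (eta F n K)⁻¹ •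
          (deltaPrimeOp (torusT (F.P K) 0) (fun ν x => bgUnits F K U₀ ⟨x, ν⟩) 1 (formComp ((toL2 F K c₀).symm u)) p.2 ((siteEquiv F K).symm p.1)
            - curvOp (torusT (F.P K) 0) (fun ν x => bgUnits F K U₀ ⟨x, ν⟩) (formComp ((toL2 F K c₀).symm u)) p.2 ((siteEquiv F K).symm p.1))‖
      ≤ Real.sqrt 2 * (32 * ε₀ * (S * Real.exp (κ * r) * Real.exp (-(κ * d p)))) := mul_le_mul_of_nonneg_left h1 h2
    _ = 32 * Real.sqrt 2 * ε₀ * Real.exp (κ * r) * S * Real.exp (-(κ * d p)) := by ring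

/-! ## §3 The stencil-Lipschitz letter DISCHARGED for O4b's block distance -/

/-- ★ **BLOCK DISTANCES OF NEARBY BONDS DIFFER BY AT MOST `5`**: if the sources of `p`, `p′` are within `ℓ¹`-distance `2` on the fine torus, then their `(K−n)`-blocks are within
`2∕ℓ + 3 ≤ 5` (✓`Prop7BlockDistanceWeights.tdist_iterBlockOf_le`), hence `tdist(B(p)₋, v) ≤ tdist(B(p′)₋, v) + 5` for every coarse site `v` — the `hd` letter of §2 for O4b's
`d p := tdist(B((bondEquiv)⁻¹p)₋, v)` with `r := 5`. [cite: Balaban1985Averaging, (2) p.17; Balaban1985BackgroundPropagators, (3.42) p.397] -/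
theorem blockDist_le_blockDist_add_five (v : Site (F.P K) (K - n)) (p p' : Bond 3 (periodsT3 F K))
    (h2 : Site.tdist ((bondEquiv F K).symm p).src ((bondEquiv F K).symm p').src ≤ 2) :
    (Site.tdist (iterBlockOf (K - n) ((bondEquiv F K).symm p).src) v : ℝ)
      ≤ (Site.tdist (iterBlockOf (K - n) ((bondEquiv F K).symm p').src) v : ℝ) + 5 := by
  have hk : K - n ≤ (F.P K).m + (F.P K).K := by show K - n ≤ F.m + K; omega
  have hB : Site.tdist (iterBlockOf (K - n) ((bondEquiv F K).symm p).src) (iterBlockOf (K - n) ((bondEquiv F K).symm p').src) ≤ 5 := by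
    have h := tdist_iterBlockOf_le hk ((bondEquiv F K).symm p).src ((bondEquiv F K).symm p').src
    have hdiv : Site.tdist ((bondEquiv F K).symm p).src ((bondEquiv F K).symm p').src / (F.P K).L ^ (K - n) ≤ 2 := (Nat.div_le_self _ _).trans h2
    have hd3 : (F.P K).d = 3 := T3Family.P_d F K
    rw [hd3] at h
    omega
  have htri := tdist_triangle (iterBlockOf (K - n) ((bondEquiv F K).symm p).src) (iterBlockOf (K - n) ((bondEquiv F K).symm p').src) v
  have hnat : Site.tdist (iterBlockOf (K - n) ((bondEquiv F K).symm p).src) v ≤ Site.tdist (iterBlockOf (K - n) ((bondEquiv F K).symm p').src) v + 5 := by omega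
  exact_mod_cast hnat

/-- ★★ **THE DECAYED LOCAL-STENCIL LETTER AT O4b's BLOCK DISTANCE** (§2 with §3, `r := 5`): on `RegPr F n K ε₀ U₀`, for every source block `v` and rate `κ ≥ 0`,
`‖frobEquiv⁻¹(η⁻¹•η⁻¹•((Δ′₁X)(p) − (𝒦X)(p)))‖ ≤ 32√2·ε₀·e^{5κ}·(⨆_{p′} ‖u(p′)‖e^{κ·tdist(B(p′)₋,v)})·e^{−κ·tdist(B(p)₋,v)}` — the `θ·S` half of O4's `hqdom` for the cosh family of
✓`Prop7OneFormCoshFamily.exists_coshFamily`, `θ := 32√2ε₀e^{5κ}`. [cite: Balaban1985BackgroundPropagators, (3.42) p.397, (3.69) p.404] -/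
theorem norm_local_remainder_le_blockDecay {ε₀ : ℝ} (U₀ : GaugeField (F.P K) 0 (Matrix.specialUnitaryGroup (Fin 2) ℂ)) (hreg : RegPr F n K ε₀ U₀)
    (u : BondL2K ℂ 3 (periodsT3 F K) c₀ W₂) (v : Site (F.P K) (K - n)) {κ : ℝ} (hκ : 0 ≤ κ) (p : Bond 3 (periodsT3 F K)) :
    ‖(frobEquiv.symm ((eta F n K)⁻¹ • (eta F n K)⁻¹ •
        (deltaPrimeOp (torusT (F.P K) 0) (fun ν x => bgUnits F K U₀ ⟨x, ν⟩) 1 (formComp ((toL2 F K c₀).symm u)) p.2 ((siteEquiv F K).symm p.1)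
          - curvOp (torusT (F.P K) 0) (fun ν x => bgUnits F K U₀ ⟨x, ν⟩) (formComp ((toL2 F K c₀).symm u)) p.2 ((siteEquiv F K).symm p.1))) : W₂)‖
      ≤ 32 * Real.sqrt 2 * ε₀ * Real.exp (κ * 5)
          * (⨆ p', ‖WL2.equiv ℂ _ W₂ u p'‖ * Real.exp (κ * (Site.tdist (iterBlockOf (K - n) ((bondEquiv F K).symm p').src) v : ℝ)))
          * Real.exp (-(κ * (Site.tdist (iterBlockOf (K - n) ((bondEquiv F K).symm p).src) v : ℝ))) :=
  norm_local_remainder_le_decay U₀ hreg u (fun p' => (Site.tdist (iterBlockOf (K - n) ((bondEquiv F K).symm p').src) v : ℝ)) hκ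
    (fun q q' hqq' => blockDist_le_blockDist_add_five v q q' hqq') p

/-! ## §4 O4's `hqdom`, assembled from the three displayed decayed letters and §2 -/

/-- ★★ **O4's `hqdom` FROM LETTERS.**  Let `q = t₁ − t₂ + t₃ + (local stencil)` pointwise — (O3d)'s∕O4's four-term remainder with the (Q) `aQ_k†Q_k u`, (D) `D(1−R_S)D*u` and
(X) `(Δx − Δ^η)u` summands abstracted to functions `t₁ t₂ t₃` (so every supplier docks by name).  If each carries a decayed letter `‖tᵢ(p)‖ ≤ (sᵢ + θᵢ·S)·e^{−κ·d p}` against the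
envelope `S = ⨆_{p′} ‖u(p′)‖e^{κ·d p′}` and `d` has the stencil-Lipschitz letter of §2, then on `RegPr F n K ε₀ U₀`
`‖q(p)‖ ≤ ((s₁+s₂+s₃) + (θ₁+θ₂+θ₃+32√2·ε₀·e^{κr})·S)·e^{−κ·d p}` — O4 ✓`pointwiseDecay_oneForm_of_letters`'s binder `hqdom` with `sD := s₁+s₂+s₃`,
`θ := θ₁+θ₂+θ₃+32√2ε₀e^{κr}`.  CONDITIONAL on the three displayed letters. [cite: Balaban1985BackgroundPropagators, Thm 3.1 (3.42) p.397, (3.69) p.404, Thm 3.12 p.422] -/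
theorem hqdom_of_letters {ε₀ : ℝ} (U₀ : GaugeField (F.P K) 0 (Matrix.specialUnitaryGroup (Fin 2) ℂ)) (hreg : RegPr F n K ε₀ U₀)
    (u : BondL2K ℂ 3 (periodsT3 F K) c₀ W₂) (t₁ t₂ t₃ q : Bond 3 (periodsT3 F K) → W₂)
    (hq : ∀ p, q p = t₁ p - t₂ p + t₃ p
      + frobEquiv.symm ((eta F n K)⁻¹ • (eta F n K)⁻¹ •
          (deltaPrimeOp (torusT (F.P K) 0) (fun ν x => bgUnits F K U₀ ⟨x, ν⟩) 1 (formComp ((toL2 F K c₀).symm u)) p.2 ((siteEquiv F K).symm p.1)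
            - curvOp (torusT (F.P K) 0) (fun ν x => bgUnits F K U₀ ⟨x, ν⟩) (formComp ((toL2 F K c₀).symm u)) p.2 ((siteEquiv F K).symm p.1))))
    (d : Bond 3 (periodsT3 F K) → ℝ) {κ r : ℝ} (hκ : 0 ≤ κ)
    (hd : ∀ p p' : Bond 3 (periodsT3 F K), Site.tdist ((bondEquiv F K).symm p).src ((bondEquiv F K).symm p').src ≤ 2 → d p ≤ d p' + r)
    {s₁ θ₁ s₂ θ₂ s₃ θ₃ : ℝ}
    (h₁ : ∀ p, ‖t₁ p‖ ≤ (s₁ + θ₁ * ⨆ p', ‖WL2.equiv ℂ _ W₂ u p'‖ * Real.exp (κ * d p')) * Real.exp (-(κ * d p)))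
    (h₂ : ∀ p, ‖t₂ p‖ ≤ (s₂ + θ₂ * ⨆ p', ‖WL2.equiv ℂ _ W₂ u p'‖ * Real.exp (κ * d p')) * Real.exp (-(κ * d p)))
    (h₃ : ∀ p, ‖t₃ p‖ ≤ (s₃ + θ₃ * ⨆ p', ‖WL2.equiv ℂ _ W₂ u p'‖ * Real.exp (κ * d p')) * Real.exp (-(κ * d p))) :
    ∀ p, ‖q p‖ ≤ ((s₁ + s₂ + s₃) + (θ₁ + θ₂ + θ₃ + 32 * Real.sqrt 2 * ε₀ * Real.exp (κ * r))
        * ⨆ p', ‖WL2.equiv ℂ _ W₂ u p'‖ * Real.exp (κ * d p')) * Real.exp (-(κ * d p)) := by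
  intro p
  have h₄ := norm_local_remainder_le_decay U₀ hreg u d hκ hd p
  rw [hq p]
  calc ‖t₁ p - t₂ p + t₃ p + frobEquiv.symm ((eta F n K)⁻¹ • (eta F n K)⁻¹ •
          (deltaPrimeOp (torusT (F.P K) 0) (fun ν x => bgUnits F K U₀ ⟨x, ν⟩) 1 (formComp ((toL2 F K c₀).symm u)) p.2 ((siteEquiv F K).symm p.1)
            - curvOp (torusT (F.P K) 0) (fun ν x => bgUnits F K U₀ ⟨x, ν⟩) (formComp ((toL2 F K c₀).symm u)) p.2 ((siteEquiv F K).symm p.1)))‖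
      ≤ ‖t₁ p‖ + ‖t₂ p‖ + ‖t₃ p‖ + ‖(frobEquiv.symm ((eta F n K)⁻¹ • (eta F n K)⁻¹ •
          (deltaPrimeOp (torusT (F.P K) 0) (fun ν x => bgUnits F K U₀ ⟨x, ν⟩) 1 (formComp ((toL2 F K c₀).symm u)) p.2 ((siteEquiv F K).symm p.1)
            - curvOp (torusT (F.P K) 0) (fun ν x => bgUnits F K U₀ ⟨x, ν⟩) (formComp ((toL2 F K c₀).symm u)) p.2 ((siteEquiv F K).symm p.1))) : W₂)‖ :=
        (norm_add_le _ _).trans (add_le_add ((norm_add_le (t₁ p - t₂ p) (t₃ p)).trans (add_le_add (norm_sub_le (t₁ p) (t₂ p)) le_rfl)) le_rfl)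
    _ ≤ (s₁ + θ₁ * ⨆ p', ‖WL2.equiv ℂ _ W₂ u p'‖ * Real.exp (κ * d p')) * Real.exp (-(κ * d p))
        + (s₂ + θ₂ * ⨆ p', ‖WL2.equiv ℂ _ W₂ u p'‖ * Real.exp (κ * d p')) * Real.exp (-(κ * d p))
        + (s₃ + θ₃ * ⨆ p', ‖WL2.equiv ℂ _ W₂ u p'‖ * Real.exp (κ * d p')) * Real.exp (-(κ * d p))
        + 32 * Real.sqrt 2 * ε₀ * Real.exp (κ * r) * (⨆ p', ‖WL2.equiv ℂ _ W₂ u p'‖ * Real.exp (κ * d p')) * Real.exp (-(κ * d p)) :=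
        add_le_add (add_le_add (add_le_add (h₁ p) (h₂ p)) (h₃ p)) h₄
    _ = _ := by ring

end Summit.QuantumFields.YangMills.Theorems.Prop7OneFormLocalRemainderDecay

end
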